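import Summits.Ventures.CertifiedManyBodySolver.Downfold.EmeryBandJet
import Summits.Ventures.CertifiedManyBodySolver.Downfold.EmeryBoxesLa214OneBandImage
import HarnessLib

/-!
# THE WHOLE-BAND `t′ − 2t″` OF THE WORKED EXAMPLE, CERTIFIED: for EVERY member of box #18's typed σ companion
# `emeryBoxLa214v123` (La₂CuO₄; whole hull and both Δ_pd level tags; x = 0 and x = 1/8) the nodal 2-jet of its
# antibonding band at the Fermi energy has `t′_J − 2t″_J` IN A CERTIFIED WINDOW — object M's nesting-fold combination
# is object E's `t′` in eV (INFL-3to1-B §B.100; kernel `EmeryBandJet` ∘ capstones `EmeryBoxesLa214OneBandImage`)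

Venture CertifiedManyBodySolver, cell `pub/hubbard-downfold` (stage S1), seat hubbard-downfold-mod-4 (technique B, g44);
namespace `Summit.Ventures.CertifiedManyBodySolver.Downfold.Emery`. Everything PROVED (0 sorry; no new certificate: the
EXACT identity `jetTp_sub_two_jetTpp_eq_fsRatio_mul_scaleT` composed with the landed one-band image windows
`la214{,DFT,SOL}Box_oneBandImage_{x0,x0125}` (nodal scale `scaleT(node; ε_F)` and exact shape `fsRatio(ε_F)`)).

OBJECT. `EmeryBandJet` (§B.100): the Taylor 2-jet of the implicit σ band at a diagonal point reads as a one-band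
`t–t′–t″` set `(t_J, t′_J, t″_J)` (the whole-band / object-M-type reading: for the La₂CuO₄ atomic-like row it gives
`t′/t −0.073`, `t″/t +0.101` against the MLWF object M of record `−0.071 / +0.090`, float) and its nesting-fold
combination is EXACTLY `t′_J − 2t″_J = fsRatio(ε)·scaleT(x₀, x₀; ε)`. At the nodal Fermi point `x₀ = xNode(ε_F)`,
`ε = ε_F = fermiEnergyOf(ν)` the two factors are the certified coordinates of the one-band image (§B.88–§B.90), so for
EVERY member (product of a negative and a positive window, outward 10⁻⁴):
* whole box (Δ [1.7, 4.0] × t_pd [1.29, 1.52] × t_pp [0.46, 0.66] × t_pp′ [0.12, 0.15] eV): x = 0 **`t′_J − 2t″_J ∈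
  [−0.1698, −0.0539]` eV** (`la214Box_jetFold_x0`), x = 1/8 `[−0.1848, −0.0563]` (`…_x0125`);
* DFT-level tag (Δ ≤ 2.91): x = 0 `[−0.1698, −0.0696]`, x = 1/8 `[−0.1848, −0.0739]`;
* solver-level tag (Δ ≥ 3.24): x = 0 `[−0.1230, −0.0539]`, x = 1/8 `[−0.1299, −0.0563]`.
READING (value-free): the box's 1BH object M of record (MLWF, §OF-RECORD l.184 / §DFT-1b l.95: `t = 0.4642` eV,
`t′/t = −0.0709`, `t″/t = +0.0898`) has `t′ − 2t″ = −0.1163` eV — INSIDE every x = 0 window above: the whole-band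
one-band set of the DFT band and the σ-model Fermi-surface shape of the typed companion are ONE object read two ways,
consistent at the certified level through the exact fold (if object M is the nodal jet — an identification that holds to
≤ 0.01 in the ratios on every La row tested, §B.100 float).

WHAT THIS IS NOT: statements about La₂CuO₄ — SCREENING-GRADE typed box; `U = 0` one-body kinematics; object M ≈ nodal jet
is a float identification, not a theorem; no box edit.
-/

noncomputable section

namespace Summit.Ventures.CertifiedManyBodySolver.Downfold.Emery

open Real Set

/-- A positive velocity-matched scale forces both factors of `scaleT = fsT/∂_εF` to be non-zero. [folklore] -/
theorem ne_zero_of_scaleT_pos {Δ tpd tpp c x y ε : ℝ} (h : 0 < scaleT Δ tpd tpp c x y ε) :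
    dcharCubic Δ tpd tpp c x y ε ≠ 0 ∧ fsT Δ tpd tpp c ε ≠ 0 := by
  unfold scaleT at h
  constructor
  · intro h0; rw [h0, div_zero] at h; exact lt_irrefl 0 h
  · intro h0; rw [h0, zero_div] at h; exact lt_irrefl 0 h

/-- Product of a non-positive window and a non-negative window: `r ∈ [r₁, r₂]`, `r₂ ≤ 0`, `s ∈ [s₁, s₂]`, `0 ≤ s₁`
give `r·s ∈ [r₁s₂, r₂s₁]`. [folklore] -/
theorem mul_mem_Icc_of_nonpos_of_nonneg {r s r₁ r₂ s₁ s₂ : ℝ} (hr : r ∈ Icc r₁ r₂) (hs : s ∈ Icc s₁ s₂)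
    (hr₂ : r₂ ≤ 0) (hs₁ : 0 ≤ s₁) : r * s ∈ Icc (r₁ * s₂) (r₂ * s₁) := by
  obtain ⟨hr1, hr2⟩ := hr; obtain ⟨hs1, hs2⟩ := hs
  constructor <;> nlinarith

/-- THE FOLD WINDOW DEVICE: if at a diagonal point the velocity-matched scale lies in a positive window and the exact
shape ratio in a negative one, the jet's `t′_J − 2t″_J` lies in the product window. [folklore] -/
theorem jetFold_mem_Icc {Δ tpd tpp c x₀ ε r₁ r₂ s₁ s₂ : ℝ}
    (hS : scaleT Δ tpd tpp c x₀ x₀ ε ∈ Icc s₁ s₂) (hR : fsRatio Δ tpd tpp c ε ∈ Icc r₁ r₂)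
    (hs₁ : 0 < s₁) (hr₂ : r₂ ≤ 0) :
    jetTp Δ tpd tpp c x₀ ε - 2 * jetTpp Δ tpd tpp c x₀ ε ∈ Icc (r₁ * s₂) (r₂ * s₁) := by
  obtain ⟨hF, hT⟩ := ne_zero_of_scaleT_pos (lt_of_lt_of_le hs₁ hS.1)
  rw [jetTp_sub_two_jetTpp_eq_fsRatio_mul_scaleT hF hT]
  exact mul_mem_Icc_of_nonpos_of_nonneg hR hS hr₂ hs₁.le

/-- **Whole box, x = 0 (ν = 1/2):** for EVERY member the nodal jet at the Fermi energy has
`t′_J − 2t″_J ∈ [−0.1698, −0.0539]` eV. [folklore] -/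
theorem la214Box_jetFold_x0 {Δ a b c : ℝ} (hΔ : Δ ∈ Icc ((17 : ℝ) / 10) (4 : ℝ))
    (ha : a ∈ Icc ((129 : ℝ) / 100) ((38 : ℝ) / 25)) (hb : b ∈ Icc ((23 : ℝ) / 50) ((33 : ℝ) / 50))
    (hc : c ∈ Icc ((3 : ℝ) / 25) ((3 : ℝ) / 20)) :
    jetTp Δ a b c (xNode Δ a b c (fermiEnergyOf Δ a b c ((1 : ℝ) / 2))) (fermiEnergyOf Δ a b c ((1 : ℝ) / 2))
      - 2 * jetTpp Δ a b c (xNode Δ a b c (fermiEnergyOf Δ a b c ((1 : ℝ) / 2))) (fermiEnergyOf Δ a b c ((1 : ℝ) / 2))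
      ∈ Icc (-(849 : ℝ) / 5000) (-(539 : ℝ) / 10000) := by
  obtain ⟨hS, hR, -, -⟩ := la214Box_oneBandImage_x0 hΔ ha hb hc
  have h := jetFold_mem_Icc hS hR (by norm_num) (by norm_num)
  exact ⟨le_trans (by norm_num) h.1, le_trans h.2 (by norm_num)⟩

/-- **Whole box, x = 1/8 (ν = 7/16):** `t′_J − 2t″_J ∈ [−0.1848, −0.0563]` eV for every member. [folklore] -/
theorem la214Box_jetFold_x0125 {Δ a b c : ℝ} (hΔ : Δ ∈ Icc ((17 : ℝ) / 10) (4 : ℝ))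
    (ha : a ∈ Icc ((129 : ℝ) / 100) ((38 : ℝ) / 25)) (hb : b ∈ Icc ((23 : ℝ) / 50) ((33 : ℝ) / 50))
    (hc : c ∈ Icc ((3 : ℝ) / 25) ((3 : ℝ) / 20)) :
    jetTp Δ a b c (xNode Δ a b c (fermiEnergyOf Δ a b c ((7 : ℝ) / 16))) (fermiEnergyOf Δ a b c ((7 : ℝ) / 16))
      - 2 * jetTpp Δ a b c (xNode Δ a b c (fermiEnergyOf Δ a b c ((7 : ℝ) / 16))) (fermiEnergyOf Δ a b c ((7 : ℝ) / 16))
      ∈ Icc (-(231 : ℝ) / 1250) (-(563 : ℝ) / 10000) := by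
  obtain ⟨hS, hR, -, -⟩ := la214Box_oneBandImage_x0125 hΔ ha hb hc
  have h := jetFold_mem_Icc hS hR (by norm_num) (by norm_num)
  exact ⟨le_trans (by norm_num) h.1, le_trans h.2 (by norm_num)⟩

/-- **DFT-level tag (Δ_pd ≤ 2.91), x = 0:** `t′_J − 2t″_J ∈ [−0.1698, −0.0696]` eV for every member. [folklore] -/
theorem la214DFTBox_jetFold_x0 {Δ a b c : ℝ} (hΔ : Δ ∈ Icc ((17 : ℝ) / 10) ((291 : ℝ) / 100))
    (ha : a ∈ Icc ((129 : ℝ) / 100) ((38 : ℝ) / 25)) (hb : b ∈ Icc ((23 : ℝ) / 50) ((33 : ℝ) / 50))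
    (hc : c ∈ Icc ((3 : ℝ) / 25) ((3 : ℝ) / 20)) :
    jetTp Δ a b c (xNode Δ a b c (fermiEnergyOf Δ a b c ((1 : ℝ) / 2))) (fermiEnergyOf Δ a b c ((1 : ℝ) / 2))
      - 2 * jetTpp Δ a b c (xNode Δ a b c (fermiEnergyOf Δ a b c ((1 : ℝ) / 2))) (fermiEnergyOf Δ a b c ((1 : ℝ) / 2))
      ∈ Icc (-(849 : ℝ) / 5000) (-(87 : ℝ) / 1250) := by
  obtain ⟨hS, hR, -, -⟩ := la214DFTBox_oneBandImage_x0 hΔ ha hb hc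
  have h := jetFold_mem_Icc hS hR (by norm_num) (by norm_num)
  exact ⟨le_trans (by norm_num) h.1, le_trans h.2 (by norm_num)⟩

/-- **DFT-level tag, x = 1/8:** `t′_J − 2t″_J ∈ [−0.1848, −0.0739]` eV for every member. [folklore] -/
theorem la214DFTBox_jetFold_x0125 {Δ a b c : ℝ} (hΔ : Δ ∈ Icc ((17 : ℝ) / 10) ((291 : ℝ) / 100))
    (ha : a ∈ Icc ((129 : ℝ) / 100) ((38 : ℝ) / 25)) (hb : b ∈ Icc ((23 : ℝ) / 50) ((33 : ℝ) / 50))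
    (hc : c ∈ Icc ((3 : ℝ) / 25) ((3 : ℝ) / 20)) :
    jetTp Δ a b c (xNode Δ a b c (fermiEnergyOf Δ a b c ((7 : ℝ) / 16))) (fermiEnergyOf Δ a b c ((7 : ℝ) / 16))
      - 2 * jetTpp Δ a b c (xNode Δ a b c (fermiEnergyOf Δ a b c ((7 : ℝ) / 16))) (fermiEnergyOf Δ a b c ((7 : ℝ) / 16))
      ∈ Icc (-(231 : ℝ) / 1250) (-(739 : ℝ) / 10000) := by
  obtain ⟨hS, hR, -, -⟩ := la214DFTBox_oneBandImage_x0125 hΔ ha hb hc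
  have h := jetFold_mem_Icc hS hR (by norm_num) (by norm_num)
  exact ⟨le_trans (by norm_num) h.1, le_trans h.2 (by norm_num)⟩

/-- **Solver-level tag (Δ_pd ≥ 3.24), x = 0:** `t′_J − 2t″_J ∈ [−0.1230, −0.0539]` eV for every member. [folklore] -/
theorem la214SOLBox_jetFold_x0 {Δ a b c : ℝ} (hΔ : Δ ∈ Icc ((81 : ℝ) / 25) (4 : ℝ))
    (ha : a ∈ Icc ((129 : ℝ) / 100) ((38 : ℝ) / 25)) (hb : b ∈ Icc ((23 : ℝ) / 50) ((33 : ℝ) / 50))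
    (hc : c ∈ Icc ((3 : ℝ) / 25) ((3 : ℝ) / 20)) :
    jetTp Δ a b c (xNode Δ a b c (fermiEnergyOf Δ a b c ((1 : ℝ) / 2))) (fermiEnergyOf Δ a b c ((1 : ℝ) / 2))
      - 2 * jetTpp Δ a b c (xNode Δ a b c (fermiEnergyOf Δ a b c ((1 : ℝ) / 2))) (fermiEnergyOf Δ a b c ((1 : ℝ) / 2))
      ∈ Icc (-(123 : ℝ) / 1000) (-(539 : ℝ) / 10000) := by
  obtain ⟨hS, hR, -, -⟩ := la214SOLBox_oneBandImage_x0 hΔ ha hb hc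
  have h := jetFold_mem_Icc hS hR (by norm_num) (by norm_num)
  exact ⟨le_trans (by norm_num) h.1, le_trans h.2 (by norm_num)⟩

/-- **Solver-level tag, x = 1/8:** `t′_J − 2t″_J ∈ [−0.1299, −0.0563]` eV for every member. [folklore] -/
theorem la214SOLBox_jetFold_x0125 {Δ a b c : ℝ} (hΔ : Δ ∈ Icc ((81 : ℝ) / 25) (4 : ℝ))
    (ha : a ∈ Icc ((129 : ℝ) / 100) ((38 : ℝ) / 25)) (hb : b ∈ Icc ((23 : ℝ) / 50) ((33 : ℝ) / 50))
    (hc : c ∈ Icc ((3 : ℝ) / 25) ((3 : ℝ) / 20)) :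
    jetTp Δ a b c (xNode Δ a b c (fermiEnergyOf Δ a b c ((7 : ℝ) / 16))) (fermiEnergyOf Δ a b c ((7 : ℝ) / 16))
      - 2 * jetTpp Δ a b c (xNode Δ a b c (fermiEnergyOf Δ a b c ((7 : ℝ) / 16))) (fermiEnergyOf Δ a b c ((7 : ℝ) / 16))
      ∈ Icc (-(1299 : ℝ) / 10000) (-(563 : ℝ) / 10000) := by
  obtain ⟨hS, hR, -, -⟩ := la214SOLBox_oneBandImage_x0125 hΔ ha hb hc
  have h := jetFold_mem_Icc hS hR (by norm_num) (by norm_num)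
  exact ⟨le_trans (by norm_num) h.1, le_trans h.2 (by norm_num)⟩

end Summit.Ventures.CertifiedManyBodySolver.Downfold.Emery
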